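import Summits.CriticalPhenomena.Ising3DConformalLimit.Theses.PerfectScreening
import Summits.CriticalPhenomena.Ising3DConformalLimit.Theorems.PerfectScreeningSubharmonicOffOriginPskDefs
import Literature.Probability.LatticeModels.CriticalTwoPointLower
import HarnessLib

/-!
# Crux `PerfectScreening.SubharmonicOffOrigin` (stmt-CriticalPhenomena-1341), line `SketchIdeator1`
# (planar-source Källén–Lehmann mixture): stub `stub_mixture_subharmonic`

This file proves the registered stub `stub_mixture_subharmonic` of the checked skeleton of the line
`SketchIdeator1` (lead `prover-line-stmt-CriticalPhenomena-1341-a1-0`; objects `massiveGreen`,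
`planeSite`, `PlanarSourceMixture` in `PerfectScreeningSubharmonicOffOriginPskDefs`): GIVEN

* positivity of the massive lattice Green functions, `0 ≤ G_s(x)` for `s ≥ 0`;
* the massive Poisson identity in stencil form,
  `(6 + s) G_s(x) − Σᵢ (G_s(x + eᵢ) + G_s(x − eᵢ)) = [x = 0]` for `s ≥ 0`;
* a planar-source mixture `criticalTwoPoint 3 x = Σ'_y ∫ G_s(x − (0,y)) dα_y(s)` with finite
  measures `α_y` carried by `[0, ∞)` and the integrability / summability bookkeeping,

the critical two-point function of `ℤ³` is lattice-subharmonic off the origin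
(`SubharmonicOffOrigin`: `6 G(x) ≤ Σᵢ (G(x + eᵢ) + G(x − eᵢ))` for `x ≠ 0`).

Proof (elementary measure theory + one lattice symmetry):
* `mixture_stencil_pointwise`: for `s ≥ 0` and `z ≠ 0` the Poisson identity reads
  `Σ_nbrs G_s − 6 G_s(z) = s·G_s(z) ≥ 0`.
* `mixture_stencil_integral_nonneg`: for one source `p` with `x − p ≠ 0` and a mass measure `μ`
  with `μ((−∞,0)) = 0`, the seven-point stencil commutes with `∫ · dμ` (integrability) and the
  integrand is `≥ 0` for `μ`-a.e. `s` (namely for `s ≥ 0`).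
* `mixture_offPlane`: OFF the source plane (`x 0 ≠ 0`, so `x − (0,y) ≠ 0` for every `y`) the
  stencil commutes with the sum over sources (`HasSum` algebra) and every summand is `≥ 0`.
* `stub_mixture_subharmonic`: ON the plane minus the origin some coordinate `x j ≠ 0`; the
  transposition `π = (0 j)` of the coordinates moves `x` off the plane, preserves
  `criticalTwoPoint 3` (`twoPointPlus_perm_invariant_holds`, Friedli–Velenik 2017, Exercise 3.14)
  and permutes the six neighbours.
-/

noncomputable section

open MeasureTheory
open Literature.Probability.LatticeModels
open Summit.CriticalPhenomena.Ising3DConformalLimit.Theses.PerfectScreening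

namespace Summit.CriticalPhenomena.Ising3DConformalLimit.Theorems.PerfectScreening.Psk

/-! ## The stencil of one massive Green function away from its source -/

/-- **Pointwise stencil.** For `s ≥ 0` and `z ≠ 0`, the massive Poisson identity and positivity give
`0 ≤ Σᵢ (G_s(z + eᵢ) + G_s(z − eᵢ)) − 6 G_s(z)` (the difference is `s·G_s(z)`). -/
theorem mixture_stencil_pointwise
    (hpos : ∀ s : ℝ, 0 ≤ s → ∀ x : Site 3, 0 ≤ massiveGreen s x)
    (hpoi : ∀ s : ℝ, 0 ≤ s → ∀ x : Site 3,
      (6 + s) * massiveGreen s x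
          - ∑ i : Fin 3, (massiveGreen s (x + Pi.single i 1) + massiveGreen s (x - Pi.single i 1))
        = if x = 0 then 1 else 0)
    {s : ℝ} (hs : 0 ≤ s) {z : Site 3} (hz : z ≠ 0) :
    0 ≤ ∑ i : Fin 3, (massiveGreen s (z + Pi.single i 1) + massiveGreen s (z - Pi.single i 1))
      - 6 * massiveGreen s z := by
  have h := hpoi s hs z
  rw [if_neg hz] at h
  have hp := mul_nonneg hs (hpos s hs z)
  linarith

/-- **One source.** For a mass measure `μ` carried by `[0, ∞)`, a source `p` and a site `x` with
`x − p ≠ 0`, if every `s ↦ G_s(z − p)` is `μ`-integrable then the seven-point stencil of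
`z ↦ ∫ G_s(z − p) dμ(s)` at `x` is nonnegative: the stencil commutes with the integral and the
integrand is `≥ 0` for `μ`-a.e. `s` by `mixture_stencil_pointwise`. -/
theorem mixture_stencil_integral_nonneg
    (hpos : ∀ s : ℝ, 0 ≤ s → ∀ x : Site 3, 0 ≤ massiveGreen s x)
    (hpoi : ∀ s : ℝ, 0 ≤ s → ∀ x : Site 3,
      (6 + s) * massiveGreen s x
          - ∑ i : Fin 3, (massiveGreen s (x + Pi.single i 1) + massiveGreen s (x - Pi.single i 1))
        = if x = 0 then 1 else 0)
    (μ : Measure ℝ) (hμ : μ (Set.Iio 0) = 0) (p x : Site 3) (hxp : x - p ≠ 0)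
    (hint : ∀ z : Site 3, Integrable (fun s => massiveGreen s (z - p)) μ) :
    0 ≤ ∑ i : Fin 3, ((∫ s, massiveGreen s (x + Pi.single i 1 - p) ∂μ)
        + ∫ s, massiveGreen s (x - Pi.single i 1 - p) ∂μ) - 6 * ∫ s, massiveGreen s (x - p) ∂μ := by
  have hae : ∀ᵐ s ∂μ, (0 : ℝ) ≤ s :=
    (measure_eq_zero_iff_ae_notMem.1 hμ).mono fun s hs => not_lt.1 hs
  have e1 : ∀ i : Fin 3, x + Pi.single i 1 - p = x - p + Pi.single i 1 := fun i =>
    add_sub_right_comm _ _ _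
  have e2 : ∀ i : Fin 3, x - Pi.single i 1 - p = x - p - Pi.single i 1 := fun i =>
    sub_right_comm _ _ _
  have h0 : 0 ≤ ∫ s, ((∑ i : Fin 3, (massiveGreen s (x + Pi.single i 1 - p)
      + massiveGreen s (x - Pi.single i 1 - p))) - 6 * massiveGreen s (x - p)) ∂μ := by
    refine integral_nonneg_of_ae ?_
    filter_upwards [hae] with s hs
    simp only [Pi.zero_apply, e1, e2]
    exact mixture_stencil_pointwise hpos hpoi hs hxp
  rw [integral_sub (integrable_finsetSum _ fun i _ => (hint _).fun_add (hint _))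
      ((hint x).const_mul 6),
    integral_finsetSum _ fun i _ => (hint _).fun_add (hint _), integral_const_mul] at h0
  have h2 : ∀ i : Fin 3, ∫ s, (massiveGreen s (x + Pi.single i 1 - p)
      + massiveGreen s (x - Pi.single i 1 - p)) ∂μ = (∫ s, massiveGreen s (x + Pi.single i 1 - p) ∂μ)
        + ∫ s, massiveGreen s (x - Pi.single i 1 - p) ∂μ :=
    fun i => integral_add (hint _) (hint _)
  simpa only [h2] using h0

/-! ## Summing the sources: subharmonicity off the source plane -/

/-- **Off the plane.** If `G(z) = Σ_y ∫ G_s(z − (0,y)) dα_y(s)` (as a `HasSum`, at every site) with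
mass measures `α_y` carried by `[0, ∞)` and integrable fibres, then `6 G(x) ≤ Σᵢ (G(x+eᵢ) + G(x−eᵢ))`
at every site `x` with `x 0 ≠ 0`: the stencil commutes with the sum over `y` and every summand is
nonnegative by `mixture_stencil_integral_nonneg` (`x − (0,y) ≠ 0` since its `0`-th coordinate is
`x 0`). -/
theorem mixture_offPlane
    (hpos : ∀ s : ℝ, 0 ≤ s → ∀ x : Site 3, 0 ≤ massiveGreen s x)
    (hpoi : ∀ s : ℝ, 0 ≤ s → ∀ x : Site 3,
      (6 + s) * massiveGreen s x
          - ∑ i : Fin 3, (massiveGreen s (x + Pi.single i 1) + massiveGreen s (x - Pi.single i 1))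
        = if x = 0 then 1 else 0)
    {α : (Fin 2 → ℤ) → Measure ℝ} (hsupp : ∀ y, α y (Set.Iio 0) = 0)
    (hint : ∀ (y : Fin 2 → ℤ) (x : Site 3),
      Integrable (fun s => massiveGreen s (x - planeSite y)) (α y))
    {G : Site 3 → ℝ}
    (hG : ∀ x : Site 3, HasSum (fun y => ∫ s, massiveGreen s (x - planeSite y) ∂(α y)) (G x))
    {x : Site 3} (hx : x 0 ≠ 0) :
    6 * G x ≤ ∑ i : Fin 3, (G (x + Pi.single i 1) + G (x - Pi.single i 1)) := by
  have hmain : HasSum (fun y => ∑ i : Fin 3,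
      ((∫ s, massiveGreen s (x + Pi.single i 1 - planeSite y) ∂(α y))
        + ∫ s, massiveGreen s (x - Pi.single i 1 - planeSite y) ∂(α y))
      - 6 * ∫ s, massiveGreen s (x - planeSite y) ∂(α y))
      (∑ i : Fin 3, (G (x + Pi.single i 1) + G (x - Pi.single i 1)) - 6 * G x) :=
    (hasSum_sum fun i _ => (hG (x + Pi.single i 1)).add (hG (x - Pi.single i 1))).sub
      ((hG x).mul_left 6)
  have hxy : ∀ y : Fin 2 → ℤ, x - planeSite y ≠ 0 := by
    intro y h
    apply hx
    have h0 := congrFun h 0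
    simpa using h0
  have key := hmain.nonneg fun y =>
    mixture_stencil_integral_nonneg hpos hpoi (α y) (hsupp y) (planeSite y) x (hxy y) (hint y)
  linarith

/-- Reindexing the six neighbours `x ± e_{π k}` of a site by a coordinate permutation `π`. -/
theorem mixture_sum_nbrs_perm (F : Site 3 → ℝ) (π : Equiv.Perm (Fin 3)) (x : Site 3) :
    ∑ k : Fin 3, (F (x + Pi.single (π k) 1) + F (x - Pi.single (π k) 1))
      = ∑ k : Fin 3, (F (x + Pi.single k 1) + F (x - Pi.single k 1)) :=
  Equiv.sum_comp π (fun k => F (x + Pi.single k 1) + F (x - Pi.single k 1))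

/-! ## The stub -/

/-- **Stub `stub_mixture_subharmonic` of line `SketchIdeator1`.** Positivity and the massive Poisson
identity of the summands turn a planar-source mixture into lattice subharmonicity of
`criticalTwoPoint 3` off the origin: off the plane `{x 0 = 0}` by `mixture_offPlane`; on the plane
minus the origin some coordinate `x j ≠ 0`, and the coordinate transposition `(0 j)` moves `x` off the
plane while preserving `criticalTwoPoint 3` (`twoPointPlus_perm_invariant_holds`) and permuting the
six neighbours `x ± eᵢ`. -/
theorem stub_mixture_subharmonic :
    (∀ s : ℝ, 0 ≤ s → ∀ x : Site 3, 0 ≤ massiveGreen s x) →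
    (∀ s : ℝ, 0 ≤ s → ∀ x : Site 3,
      (6 + s) * massiveGreen s x
          - ∑ i : Fin 3, (massiveGreen s (x + Pi.single i 1) + massiveGreen s (x - Pi.single i 1))
        = if x = 0 then 1 else 0) →
    PlanarSourceMixture → SubharmonicOffOrigin := by
  intro hpos hpoi hpsm x hx
  obtain ⟨α, _, hsupp, hint, hsum, hrep⟩ := hpsm
  have hG : ∀ z : Site 3,
      HasSum (fun y => ∫ s, massiveGreen s (z - planeSite y) ∂(α y)) (criticalTwoPoint 3 z) := by
    intro z
    rw [hrep z]
    exact (hsum z).hasSum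
  obtain ⟨π, hπ⟩ : ∃ π : Equiv.Perm (Fin 3), x (π 0) ≠ 0 := by
    obtain ⟨j, hj⟩ := Function.ne_iff.1 hx
    exact ⟨Equiv.swap 0 j, by simpa using hj⟩
  have hperm : ∀ z : Site 3, criticalTwoPoint 3 (fun i => z (π i)) = criticalTwoPoint 3 z :=
    fun z => twoPointPlus_perm_invariant_holds (criticalBeta_nonneg 3) π z
  have key := mixture_offPlane hpos hpoi hsupp hint hG (x := fun i => x (π i)) hπ
  have f1 : ∀ k : Fin 3, criticalTwoPoint 3 ((fun i => x (π i)) + Pi.single k 1)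
      = criticalTwoPoint 3 (x + Pi.single (π k) 1) := by
    intro k
    rw [← hperm (x + Pi.single (π k) 1)]
    congr 1
    funext i
    simp [Pi.single_apply]
  have f2 : ∀ k : Fin 3, criticalTwoPoint 3 ((fun i => x (π i)) - Pi.single k 1)
      = criticalTwoPoint 3 (x - Pi.single (π k) 1) := by
    intro k
    rw [← hperm (x - Pi.single (π k) 1)]
    congr 1
    funext i
    simp [Pi.single_apply]
  calc 6 * criticalTwoPoint 3 x = 6 * criticalTwoPoint 3 (fun i => x (π i)) := by rw [hperm]
    _ ≤ ∑ k : Fin 3, (criticalTwoPoint 3 ((fun i => x (π i)) + Pi.single k 1)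
          + criticalTwoPoint 3 ((fun i => x (π i)) - Pi.single k 1)) := key
    _ = ∑ k : Fin 3, (criticalTwoPoint 3 (x + Pi.single (π k) 1)
          + criticalTwoPoint 3 (x - Pi.single (π k) 1)) := by simp only [f1, f2]
    _ = ∑ k : Fin 3, (criticalTwoPoint 3 (x + Pi.single k 1) + criticalTwoPoint 3 (x - Pi.single k 1)) :=
      mixture_sum_nbrs_perm (criticalTwoPoint 3) π x

end Summit.CriticalPhenomena.Ising3DConformalLimit.Theorems.PerfectScreening.Psk

end
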